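import Summits.CriticalPhenomena.PercolationContinuityZ3.Theorems.PercNearOneGluingNoHeavyPcintSignedConfigSeries
import HarnessLib

/-!
# CriticalPhenomena/PercolationContinuityZ3 — Theorems/PercNearOneGluingNoHeavyPcintSignedConfigSeriesE.lean: unrolling the gap recursion — the arch series `eS S = Σ_j H_j · SS_j(S)`

Lane prim-pcint, STRUCTURE rule «numerics ⇒ structure ⇒ conjecture» (prim-pcint-2 GEN 22); sequel of …PcintSignedConfigSeries.  Iterating the gap
recursion `epS i S = Σ_t fS (S.take t) · (epS (i+1) (S.drop t) + g(i+2)·[S.drop t = []]·X^{i+2})` (`g n = #goodSet (Fin n)`, the Touchard–Riordan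
numbers at even `n`, zero at odd `n`) down to the all-core base expresses the arch series through WEAK SPLIT PRODUCTS
`WS r S = Σ_{S = T₁ ⋯ T_r} Π fS(T_i)` (`coeff_eS_eq_sum_WS`); regrouping the weak splits by their non-empty pieces (`WS r = Σ_j C(r, j) SS_j`,
`WS_eq_sum_SS`) gives  **`eS S = Σ_{j ≤ |S|} H_j · SS_j(S)`**  (`eS_eq_sum`) with `H_j = Σ_{n ≥ 2} g(n)·C(n−1, j)·X^n` — an arch is an irreducible
CORE with `j` of its `n − 1` gaps filled by non-empty `F`-objects.

HONEST FRAMING: coefficient bookkeeping only.  No `sorry`; standard axioms.  Written by prim-pcint-2 gen 22 (prover-prim-pcint-2-g22-0), 2026-08-27.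
-/

open PowerSeries

namespace Summit.CriticalPhenomena.PercolationContinuityZ3.Theorems.Pcint.ChordDiag

/-! ### Split products, core weights -/

/-- `g(n) = #goodSet (Fin n)`: the number of irreducible chord diagrams on `n` points. [folklore] -/
noncomputable def gsz (n : ℕ) : ℤ := (goodSet (Fin n)).card

/-- WEAK split products: `WS r S = Σ` over the splittings `S = T₁ ++ ⋯ ++ T_r` (pieces possibly empty) of `Π fS(T_i)`. [folklore] -/
noncomputable def WS : ℕ → List Bool → ℤ⟦X⟧
  | 0, S => nilC S
  | r + 1, S => ∑ t ∈ Finset.range (S.length + 1), fS (S.take t) * WS r (S.drop t)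

/-- STRICT split products: `SS j S = Σ` over the splittings of `S` into `j` NON-EMPTY consecutive pieces of `Π fS(T_i)`. [folklore] -/
noncomputable def SS : ℕ → List Bool → ℤ⟦X⟧
  | 0, S => nilC S
  | j + 1, S => ∑ t ∈ Finset.range S.length, fS (S.take (t + 1)) * SS j (S.drop (t + 1))

/-- The CORE series with `j` marked gaps: `H_j = Σ_{n ≥ 2} g(n)·C(n−1, j)·X^n`. [folklore] -/
noncomputable def HS (j : ℕ) : ℤ⟦X⟧ := PowerSeries.mk fun n => if 2 ≤ n then gsz n * ((n - 1).choose j : ℤ) else 0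

/-- The partial unrolling `Σ_{r < d} g(i+2+r)·X^{i+2+r}·WS (r+1) S`. [folklore] -/
noncomputable def eTail (d i : ℕ) (S : List Bool) : ℤ⟦X⟧ :=
  ∑ r ∈ Finset.range d, C (gsz (i + 2 + r)) * X ^ (i + 2 + r) * WS (r + 1) S

/-! ### Unrolling the gap recursion -/

/-- Products agree in low degree when the right factors do. [folklore] -/
theorem coeff_mul_congr_of_le {F Y Y' : ℤ⟦X⟧} {M : ℕ} (h : ∀ b, b ≤ M → coeff b Y = coeff b Y') {N : ℕ} (hN : N ≤ M) :
    coeff N (F * Y) = coeff N (F * Y') := by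
  rw [coeff_mul, coeff_mul]
  refine Finset.sum_congr rfl fun p hp => ?_
  rw [Finset.mem_antidiagonal] at hp
  rw [h p.2 (by omega)]

/-- The gap recursion, base term collected: `epS i S = Σ_t fS (S.take t)·epS (i+1) (S.drop t) + g(i+2)·X^{i+2}·WS 1 S`. [folklore] -/
theorem epS_rec' (i : ℕ) (S : List Bool) :
    epS i S = ∑ t ∈ Finset.range (S.length + 1), fS (S.take t) * epS (i + 1) (S.drop t) + C (gsz (i + 2)) * X ^ (i + 2) * WS 1 S := by
  rw [epS_rec, show WS 1 S = ∑ t ∈ Finset.range (S.length + 1), fS (S.take t) * WS 0 (S.drop t) from rfl, Finset.mul_sum,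
    ← Finset.sum_add_distrib]
  refine Finset.sum_congr rfl fun t _ => ?_
  rw [show WS 0 (S.drop t) = nilC (S.drop t) from rfl]
  unfold nilC gsz
  split_ifs
  · simp; ring
  · simp

/-- The partial unrolling satisfies the same recursion: `eTail (d+1) i S = Σ_t fS (S.take t)·eTail d (i+1) (S.drop t) + g(i+2)·X^{i+2}·WS 1 S`.
[folklore] -/
theorem eTail_succ (d i : ℕ) (S : List Bool) :
    eTail (d + 1) i S = ∑ t ∈ Finset.range (S.length + 1), fS (S.take t) * eTail d (i + 1) (S.drop t) + C (gsz (i + 2)) * X ^ (i + 2) * WS 1 S := by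
  unfold eTail
  rw [Finset.sum_range_succ', Nat.add_zero]
  congr 1
  -- the terms `r + 1`: push the sum over `t` inside
  have : ∀ r ∈ Finset.range d, C (gsz (i + 2 + (r + 1))) * X ^ (i + 2 + (r + 1)) * WS (r + 1 + 1) S =
      ∑ t ∈ Finset.range (S.length + 1), fS (S.take t) * (C (gsz (i + 1 + 2 + r)) * X ^ (i + 1 + 2 + r) * WS (r + 1) (S.drop t)) := by
    intro r _
    rw [show WS (r + 1 + 1) S = ∑ t ∈ Finset.range (S.length + 1), fS (S.take t) * WS (r + 1) (S.drop t) from rfl, Finset.mul_sum]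
    refine Finset.sum_congr rfl fun t _ => ?_
    rw [show i + 2 + (r + 1) = i + 1 + 2 + r by ring]
    ring
  rw [Finset.sum_congr rfl this, Finset.sum_comm]
  refine Finset.sum_congr rfl fun t _ => ?_
  rw [Finset.mul_sum]

/-- **Unrolling**: in degrees `N ≤ i + 1 + d` the series `epS i S` agrees with the partial unrolling `eTail d i S`. [folklore] -/
theorem coeff_epS_eq_eTail (d : ℕ) : ∀ (i : ℕ) (S : List Bool) (N : ℕ), N ≤ i + 1 + d → coeff N (epS i S) = coeff N (eTail d i S) := by
  induction d with
  | zero =>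
    intro i S N hN
    rw [coeff_epS, if_neg (by omega)]
    unfold eTail
    simp
  | succ d ih =>
    intro i S N hN
    rw [epS_rec', eTail_succ, map_add, map_add, map_sum, map_sum]
    congr 1
    refine Finset.sum_congr rfl fun t _ => ?_
    exact coeff_mul_congr_of_le (M := i + 1 + 1 + d) (fun b hb => ih (i + 1) (S.drop t) b hb) (by omega)

/-- **The arch series as a sum of weak split products**: `coeff N (eS S) = Σ_{r < N} g(r+2)·coeff N (X^{r+2}·WS (r+1) S)`. [folklore] -/
theorem coeff_eS_eq_sum_WS (S : List Bool) (N : ℕ) :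
    coeff N (eS S) = ∑ r ∈ Finset.range N, gsz (r + 2) * coeff N (X ^ (r + 2) * WS (r + 1) S) := by
  rw [eS_eq_epS_zero, coeff_epS_eq_eTail N 0 S N (by omega)]
  unfold eTail
  rw [map_sum]
  refine Finset.sum_congr rfl fun r _ => ?_
  rw [show 0 + 2 + r = r + 2 by ring, mul_assoc, coeff_C_mul]

/-! ### Weak splits by their non-empty pieces -/

/-- Too many non-empty pieces: `SS j S = 0` for `j > |S|`. [folklore] -/
theorem SS_eq_zero : ∀ (j : ℕ) (S : List Bool), S.length < j → SS j S = 0 := by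
  intro j
  induction j with
  | zero => intro S h; omega
  | succ j ih =>
    intro S h
    show ∑ t ∈ Finset.range S.length, fS (S.take (t + 1)) * SS j (S.drop (t + 1)) = 0
    refine Finset.sum_eq_zero fun t ht => ?_
    rw [Finset.mem_range] at ht
    rw [ih (S.drop (t + 1)) (by rw [List.length_drop]; omega), mul_zero]

/-- **Weak splits regrouped by their non-empty pieces**: `WS r S = Σ_{j ≤ r} C(r, j)·SS j S`. [folklore] -/
theorem WS_eq_sum_SS : ∀ (r : ℕ) (S : List Bool), WS r S = ∑ j ∈ Finset.range (r + 1), C ((r.choose j : ℕ) : ℤ) * SS j S := by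
  intro r
  induction r with
  | zero => intro S; simp [WS, SS]
  | succ r ih =>
    intro S
    show ∑ t ∈ Finset.range (S.length + 1), fS (S.take t) * WS r (S.drop t) = _
    -- split off `t = 0` (the empty first piece, `fS [] = 1`)
    rw [Finset.range_eq_Ico, Finset.sum_eq_sum_Ico_succ_bot (by omega), List.take_zero, List.drop_zero, fS_nil, one_mul, ih S]
    have hrest : ∑ t ∈ Finset.Ico 1 (S.length + 1), fS (S.take t) * WS r (S.drop t) =
        ∑ j ∈ Finset.range (r + 1), C ((r.choose j : ℕ) : ℤ) * SS (j + 1) S := by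
      rw [Finset.sum_congr rfl fun t _ => by rw [ih (S.drop t), Finset.mul_sum], Finset.sum_comm]
      refine Finset.sum_congr rfl fun j _ => ?_
      rw [show SS (j + 1) S = ∑ t ∈ Finset.range S.length, fS (S.take (t + 1)) * SS j (S.drop (t + 1)) from rfl, Finset.mul_sum,
        Finset.sum_Ico_eq_sum_range]
      refine Finset.sum_congr rfl fun t _ => ?_
      rw [add_comm 1 t]
      ring
    rw [hrest]
    have eR : ∑ j ∈ Finset.range (r + 1 + 1), C ((((r + 1).choose j : ℕ) : ℤ)) * SS j S =
        ∑ j ∈ Finset.range (r + 1), C (((r.choose j : ℕ) : ℤ)) * SS (j + 1) S +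
          ∑ j ∈ Finset.range (r + 1), C (((r.choose (j + 1) : ℕ) : ℤ)) * SS (j + 1) S + SS 0 S := by
      rw [Finset.sum_range_succ', ← Finset.sum_add_distrib]
      congr 1
      · refine Finset.sum_congr rfl fun j _ => ?_
        rw [Nat.choose_succ_succ, Nat.cast_add, map_add, add_mul]
      · simp
    have eL : ∑ j ∈ Finset.range (r + 1), C (((r.choose j : ℕ) : ℤ)) * SS j S =
        ∑ j ∈ Finset.range r, C (((r.choose (j + 1) : ℕ) : ℤ)) * SS (j + 1) S + SS 0 S := by
      rw [Finset.sum_range_succ']; simp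
    have eM : ∑ j ∈ Finset.range (r + 1), C (((r.choose (j + 1) : ℕ) : ℤ)) * SS (j + 1) S =
        ∑ j ∈ Finset.range r, C (((r.choose (j + 1) : ℕ) : ℤ)) * SS (j + 1) S := by
      rw [Finset.sum_range_succ, Nat.choose_succ_self]; simp
    rw [eR, eL, eM]; ring

/-! ### The arch series -/

/-- Coefficients of `H_j`. [folklore] -/
theorem coeff_HS (j n : ℕ) : coeff n (HS j) = if 2 ≤ n then gsz n * ((n - 1).choose j : ℤ) else 0 := by
  simp [HS]

/-- Shifting a sum by two. [folklore] -/
theorem sum_range_shift_two (G : ℕ → ℤ) (N : ℕ) :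
    ∑ r ∈ Finset.range N, G r = ∑ a ∈ Finset.range (N + 2), if 2 ≤ a then G (a - 2) else 0 := by
  induction N with
  | zero => simp [Finset.sum_range_succ]
  | succ N ih =>
    rw [Finset.sum_range_succ, ih, Finset.sum_range_succ (fun a => if 2 ≤ a then G (a - 2) else 0) (N + 2), if_pos (by omega),
      Nat.add_sub_cancel]

/-- **The arch series**: `eS S = Σ_{j ≤ |S|} H_j · SS j S` — an arch is an irreducible core with `j` gaps filled by non-empty `F`-objects.
[folklore] -/
theorem eS_eq_sum (S : List Bool) : eS S = ∑ j ∈ Finset.range (S.length + 1), HS j * SS j S := by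
  ext N
  -- the common value of both sides, coefficient of `SS j S` by coefficient
  set cm : ℕ → ℤ := fun j => ∑ a ∈ Finset.range (N + 1),
    if 2 ≤ a then gsz a * (((a - 1).choose j : ℕ) : ℤ) * coeff (N - a) (SS j S) else 0 with hcm
  have hR : ∀ j, coeff N (HS j * SS j S) = cm j := by
    intro j
    rw [coeff_mul, Finset.Nat.sum_antidiagonal_eq_sum_range_succ (fun a b => coeff a (HS j) * coeff b (SS j S)), hcm]
    refine Finset.sum_congr rfl fun a _ => ?_
    rw [coeff_HS]
    split_ifs <;> ring
  have hcm0 : ∀ j, N < j → cm j = 0 := fun j hj => by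
    rw [hcm]
    refine Finset.sum_eq_zero fun a ha => ?_
    rw [Finset.mem_range] at ha
    split_ifs
    · rw [Nat.choose_eq_zero_of_lt (by omega)]; simp
    · rfl
  have hcm1 : ∀ j, S.length < j → cm j = 0 := fun j hj => by
    rw [hcm]
    refine Finset.sum_eq_zero fun a _ => ?_
    rw [SS_eq_zero j S hj]
    split_ifs <;> simp
  have hL : coeff N (eS S) = ∑ j ∈ Finset.range (N + 1), cm j := by
    rw [coeff_eS_eq_sum_WS, sum_range_shift_two (fun r => gsz (r + 2) * coeff N (X ^ (r + 2) * WS (r + 1) S)) N]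
    -- the term `a = N + 1` vanishes; the others are `g(a)·coeff_{N−a}(WS (a−1) S)`
    rw [Finset.sum_range_succ]
    have hlast : (if 2 ≤ N + 1 then gsz (N + 1 - 2 + 2) * coeff N (X ^ (N + 1 - 2 + 2) * WS (N + 1 - 2 + 1) S) else 0) = 0 := by
      split_ifs with h
      · rw [show N + 1 - 2 + 2 = N + 1 by omega, PowerSeries.coeff_X_pow_mul', if_neg (by omega), mul_zero]
      · rfl
    rw [hlast, add_zero]
    have hterm : ∀ a ∈ Finset.range (N + 1), (if 2 ≤ a then gsz (a - 2 + 2) * coeff N (X ^ (a - 2 + 2) * WS (a - 2 + 1) S) else 0) =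
        ∑ j ∈ Finset.range (N + 1), if 2 ≤ a then gsz a * (((a - 1).choose j : ℕ) : ℤ) * coeff (N - a) (SS j S) else 0 := by
      intro a ha
      rw [Finset.mem_range] at ha
      split_ifs with h2
      · rw [show a - 2 + 2 = a by omega, show a - 2 + 1 = a - 1 by omega, PowerSeries.coeff_X_pow_mul', if_pos (by omega),
          WS_eq_sum_SS, show a - 1 + 1 = a by omega, map_sum, Finset.mul_sum]
        rw [← Finset.sum_subset (Finset.range_subset_range.2 (show a ≤ N + 1 by omega)) (fun j hj hj' => by
          rw [Finset.mem_range] at hj hj'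
          rw [Nat.choose_eq_zero_of_lt (by omega)]; simp)]
        refine Finset.sum_congr rfl fun j _ => ?_
        rw [coeff_C_mul]; ring
      · simp
    rw [Finset.sum_congr rfl hterm, Finset.sum_comm]
  rw [hL, map_sum, Finset.sum_congr rfl fun j _ => hR j]
  -- both index ranges extend to a common one
  rw [Finset.sum_subset (Finset.range_subset_range.2 (show N + 1 ≤ N + S.length + 2 by omega)) (fun j _ hj' => by
      rw [Finset.mem_range] at hj'; exact hcm0 j (by omega)),
    Finset.sum_subset (Finset.range_subset_range.2 (show S.length + 1 ≤ N + S.length + 2 by omega)) (fun j _ hj' => by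
      rw [Finset.mem_range] at hj'; exact hcm1 j (by omega))]

end Summit.CriticalPhenomena.PercolationContinuityZ3.Theorems.Pcint.ChordDiag
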